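import Mathlib
import Summits.Ventures.PercRepro2.HCov
import Summits.Ventures.PercRepro2.BHKAvoid
import Summits.Ventures.PercRepro2.ExploreA3
import Summits.Ventures.PercRepro2.RootLeafUSigns
import Summits.Ventures.PercRepro2.RootLeafUHalf
import Summits.Ventures.PercRepro2.RootLeafUOu
import Summits.Ventures.PercRepro2.RootLeafUTowerBHK
import Summits.Ventures.PercRepro2.RootLeafUClaimI
import Summits.Ventures.PercRepro2.RootLeafUClaimIII

/-!
# The master identity of the o-pocket `L` half and the reduction `0 ≤ T2oL ⟸ 0 ≤ B1` for EVERY instance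
(blind cell PercRepro2, p4 g24; S3 (G4-u), proofs/P4-G24-OPOCKETL-MASTER.md §5; S3 v88 (am) ADDENDUM)

With the o-free core `(OU) = T2oL(o := u)` (RootLeafUOu: `0 ≤ (OU)` for every instance) and the whole-instance masses
`t = P(T)`, `ToL = P(T, oL)`, `D = P(PD)`, `W = P(R) = D + t`:

* **`OU_eq`**: `T2oL(o := u) = A·D + 2α·t + 2β·P(T, bL) − 2β·P(R, bK)`;
* **`master_identity`**: `X1 := t·T2oL − ToL·(OU) = A·δ + 2β·B1 − 2β·B2` with `δ = t·P(PD,oL) − D·P(T,oL)`,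
  `B1 = t·P(T,oL,bL) − P(T,oL)·P(T,bL)`, `B2 = t·P(R,oL,bK) − P(T,oL)·P(R,bK)` (a `ring` identity: `T2oL` and `(OU)`
  share the coefficients `A, 2α, 2β`, the `α`-terms cancel);
* **`T2oL_nonneg_of_B1`**: `0 ≤ B1 → 0 ≤ T2oL`, for every finite graph and every weight vector — by
  `W·X1 ≥ δ·(W·A − 2β·P(R,bK)) + 2β·W·B1 ≥ 0` (BHK06 Thm 1.4 on `R` for `W·B2 ≤ P(R,bK)·δ` = `bhk_cross_cluster_avoid`,
  `0 ≤ δ` = `ToL_mul_D_le`, claim (i) = `claim_i`), hence `W·t·T2oL = W·X1 + W·ToL·(OU) ≥ 0` and `0 ≤ T2oL` when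
  `t > 0`; when `t = 0`, `T2oL = A·P(PD,oL) − 2β·P(PD,oL,bK) ≥ 0` is claim (iii) = `claim_iii`.

So the `o ∈ L` half of the second root-leaf coefficient is nonnegative on EVERY instance where `B1 ≥ 0`, i.e. where,
given `T = {u ↮ a₂, u ↮ c, a₂ ↔ c}`, the events `o ∈ C_u` and `b ∈ C_u` are positively correlated — the ONE
place where the pocket structure enters (RootLeafUPocketB1: `B1 ≥ 0` on every boundary-`{u, a₂, o}` pocket; `B1 < 0`
is possible in general, e.g. on the 3 × 3 grid with `u` at the centre, `o` left, `b` right, `a₂` top, `c` bottom).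
-/

namespace Summit.Ventures.PercRepro2

open UnionCluster CovForm

namespace RootLeafU

namespace LMaster

variable {V : Type*} {E : Type*} [Fintype E] [DecidableEq E] [Fintype V] [DecidableEq V]
  {R : Type*} [Field R] [LinearOrder R] [IsStrictOrderedRing R]

variable (p : E → R) (ends : E → Sym2 V) (o a₂ c b u : V)

omit [Fintype V] [DecidableEq V] [LinearOrder R] [IsStrictOrderedRing R] in
/-- **The o-free core** `T2oL(o := u)` in the whole-instance masses. -/
theorem OU_eq :
    T2oL p ends u a₂ c b u = ((prob p (PDEvent ends u a₂ c) * prob p (connEvent ends a₂ b) + prob p (avoidAll ends a₂ {c}) * gap p ends u a₂ b) + (prob p Set.univ * EQb3 p ends u a₂ c b + prob p Set.univ * PDb p ends u a₂ c b + prob p (connEvent ends a₂ b) * EQ3 p ends u a₂ c + prob p (connEvent ends a₂ b) * prob p (avoidAll ends a₂ {u}) - (prob p Set.univ - prob p (avoidAll ends a₂ {c})) * gap p ends u a₂ b)) * prob p (PDEvent ends u a₂ c) + 2 * (prob p (PDEvent ends u a₂ c) * prob p (connEvent ends a₂ b) + prob p (avoidAll ends a₂ {c}) * gap p ends u a₂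 b) * prob p (TEvent ends u a₂ c) + 2 * (prob p Set.univ * prob p (PDEvent ends u a₂ c) + prob p (avoidAll ends a₂ {c}) * prob p (avoidAll ends a₂ {u})) * prob p (TEvent ends u a₂ c ∩ connEvent ends u b) - 2 * (prob p Set.univ * prob p (PDEvent ends u a₂ c) + prob p (avoidAll ends a₂ {c}) * prob p (avoidAll ends a₂ {u})) * (prob p (PDEvent ends u a₂ c ∩ connEvent ends a₂ b) + prob p (TEvent ends u a₂ c ∩ connEvent ends a₂ b)) := by
  unfold T2oL
  rw [connEvent_self ends u]
  simp only [Set.inter_univ, Set.univ_inter]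

omit [Fintype V] [DecidableEq V] [LinearOrder R] [IsStrictOrderedRing R] in
/-- **The master identity**: `t·T2oL − ToL·(OU) = A·δ + 2β·B1 − 2β·B2`. -/
theorem master_identity :
    prob p (TEvent ends u a₂ c) * T2oL p ends o a₂ c b u - prob p (TEvent ends u a₂ c ∩ connEvent ends u o) * (((prob p (PDEvent ends u a₂ c) * prob p (connEvent ends a₂ b) + prob p (avoidAll ends a₂ {c}) * gap p ends u a₂ b) + (prob p Set.univ * EQb3 p ends u a₂ c b + prob p Set.univ * PDb p ends u a₂ c b + prob p (connEvent ends a₂ b) * EQ3 p ends u a₂ c + prob p (connEvent ends a₂ b) * prob p (avoidAll ends a₂ {u}) - (prob p Set.univ - prob p (avoidAll ends a₂ {c})) * gap p ends u a₂ b)) * prob p (PDEvent ends u a₂ c) + 2 * (prob p (PDEvent ends u a₂ c) * prob p (connEvent ends a₂ b) + prob p (avoidAll ends a₂ {c}) * gap p ends u a₂ b) * prob p (TEvent ends u a₂ c) + 2 * (prob p Set.univ * prob p (PDEvent ends u a₂ c) + prob p (avoidAll ends a₂ {c}) * prob p (avoidAll ends a₂ {u})) * prob p (TEvent ends u a₂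 c ∩ connEvent ends u b) - 2 * (prob p Set.univ * prob p (PDEvent ends u a₂ c) + prob p (avoidAll ends a₂ {c}) * prob p (avoidAll ends a₂ {u})) * (prob p (PDEvent ends u a₂ c ∩ connEvent ends a₂ b) + prob p (TEvent ends u a₂ c ∩ connEvent ends a₂ b))) =
      ((prob p (PDEvent ends u a₂ c) * prob p (connEvent ends a₂ b) + prob p (avoidAll ends a₂ {c}) * gap p ends u a₂ b) + (prob p Set.univ * EQb3 p ends u a₂ c b + prob p Set.univ * PDb p ends u a₂ c b + prob p (connEvent ends a₂ b) * EQ3 p ends u a₂ c + prob p (connEvent ends a₂ b) * prob p (avoidAll ends a₂ {u}) - (prob p Set.univ - prob p (avoidAll ends a₂ {c})) * gap p ends u a₂ b)) * (prob p (TEvent ends u a₂ c) * prob p (PDEvent ends u a₂ c ∩ connEvent ends u o) - prob p (PDEvent ends u a₂ c) * prob p (TEvent ends u a₂ c ∩ connEvent ends u o)) + 2 * (prob p Set.univ * prob p (PDEvent ends u a₂ c) + prob p (avoidAll ends a₂ {c}) * prob p (avoidAll ends a₂ {u})) * (prob p (TEvent ends u a₂ c) * prob p (TEvent ends u a₂ c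 ∩ (connEvent ends u o ∩ connEvent ends u b)) - prob p (TEvent ends u a₂ c ∩ connEvent ends u o) * prob p (TEvent ends u a₂ c ∩ connEvent ends u b)) - 2 * (prob p Set.univ * prob p (PDEvent ends u a₂ c) + prob p (avoidAll ends a₂ {c}) * prob p (avoidAll ends a₂ {u})) * (prob p (TEvent ends u a₂ c) * (prob p (PDEvent ends u a₂ c ∩ (connEvent ends u o ∩ connEvent ends a₂ b)) + prob p (TEvent ends u a₂ c ∩ (connEvent ends u o ∩ connEvent ends a₂ b))) - prob p (TEvent ends u a₂ c ∩ connEvent ends u o) * (prob p (PDEvent ends u a₂ c ∩ connEvent ends a₂ b) + prob p (TEvent ends u a₂ c ∩ connEvent ends a₂ b))) := by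
  unfold T2oL
  ring

omit [Fintype V] [DecidableEq V] [LinearOrder R] [IsStrictOrderedRing R] in
/-- `W·t·T2oL = W·X1 + W·ToL·(OU)`. -/
theorem W_mul_t_mul_T2oL_eq :
    (prob p (PDEvent ends u a₂ c) + prob p (TEvent ends u a₂ c)) * prob p (TEvent ends u a₂ c) * T2oL p ends o a₂ c b u =
      (prob p (PDEvent ends u a₂ c) + prob p (TEvent ends u a₂ c)) * (prob p (TEvent ends u a₂ c) * T2oL p ends o a₂ c b u - prob p (TEvent ends u a₂ c ∩ connEvent ends u o) * (((prob p (PDEvent ends u a₂ c) * prob p (connEvent ends a₂ b) + prob p (avoidAll ends a₂ {c}) * gap p ends u a₂ b) + (prob p Set.univ * EQb3 p ends u a₂ c b + prob p Set.univ * PDb p ends u a₂ c b + prob p (connEvent ends a₂ b) * EQ3 p ends u a₂ c + prob p (connEvent ends a₂ b) * prob p (avoidAll ends a₂ {u}) - (prob p Set.univ - prob p (avoidAll ends a₂ {c})) * gap p ends u a₂ b)) * prob p (PDEvent ends u a₂ c) + 2 * (prob p (PDEvent ends u a₂ c) * prob p (connEvent ends a₂ b) + prob p (avoidAll ends a₂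 {c}) * gap p ends u a₂ b) * prob p (TEvent ends u a₂ c) + 2 * (prob p Set.univ * prob p (PDEvent ends u a₂ c) + prob p (avoidAll ends a₂ {c}) * prob p (avoidAll ends a₂ {u})) * prob p (TEvent ends u a₂ c ∩ connEvent ends u b) - 2 * (prob p Set.univ * prob p (PDEvent ends u a₂ c) + prob p (avoidAll ends a₂ {c}) * prob p (avoidAll ends a₂ {u})) * (prob p (PDEvent ends u a₂ c ∩ connEvent ends a₂ b) + prob p (TEvent ends u a₂ c ∩ connEvent ends a₂ b)))) + (prob p (PDEvent ends u a₂ c) + prob p (TEvent ends u a₂ c)) * prob p (TEvent ends u a₂ c ∩ connEvent ends u o) * (((prob p (PDEvent ends u a₂ c) * prob p (connEvent ends a₂ b) + prob p (avoidAll ends a₂ {c}) * gap p ends u a₂ b) + (prob p Set.univ * EQb3 p ends u a₂ c b + prob p Set.univ * PDb p ends u a₂ c b + prob p (connEvent ends a₂ b) * EQ3 p ends u a₂ c + prob p (connEvent ends a₂ b) * prob p (avoidAll ends a₂ {u}) - (prob p Set.univ - prob p (avoidAll ends a₂ {c})) * gap p ends u a₂ b)) * prob p (PDEvent ends u a₂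 c) + 2 * (prob p (PDEvent ends u a₂ c) * prob p (connEvent ends a₂ b) + prob p (avoidAll ends a₂ {c}) * gap p ends u a₂ b) * prob p (TEvent ends u a₂ c) + 2 * (prob p Set.univ * prob p (PDEvent ends u a₂ c) + prob p (avoidAll ends a₂ {c}) * prob p (avoidAll ends a₂ {u})) * prob p (TEvent ends u a₂ c ∩ connEvent ends u b) - 2 * (prob p Set.univ * prob p (PDEvent ends u a₂ c) + prob p (avoidAll ends a₂ {c}) * prob p (avoidAll ends a₂ {u})) * (prob p (PDEvent ends u a₂ c ∩ connEvent ends a₂ b) + prob p (TEvent ends u a₂ c ∩ connEvent ends a₂ b))) := by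
  ring

omit [Fintype E] [DecidableEq E] [Fintype V] [LinearOrder R] [IsStrictOrderedRing R] in
/-- The event `R ∩ {o ∈ L} ∩ {b ∈ K}` in exploration form. -/
lemma oL_bK_R_eq :
    connEvent ends u o ∩ connEvent ends a₂ b ∩ avoidAll ends u {a₂, c} =
      avoidAll ends u {a₂, c} ∩ (connEvent ends u o ∩ connEvent ends a₂ b) := by
  ext ω
  simp only [Set.mem_inter_iff]
  tauto

/-- **BHK06 Thm 1.4 on `R`**: `P(R, oL, bK) · W ≤ P(R, oL) · P(R, bK)`, in the split masses. -/
lemma R_oL_bK_mul_W_le (hp : IsProbVec p) :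
    (prob p (PDEvent ends u a₂ c ∩ (connEvent ends u o ∩ connEvent ends a₂ b)) + prob p (TEvent ends u a₂ c ∩ (connEvent ends u o ∩ connEvent ends a₂ b))) * (prob p (PDEvent ends u a₂ c) + prob p (TEvent ends u a₂ c)) ≤ (prob p (PDEvent ends u a₂ c ∩ connEvent ends u o) + prob p (TEvent ends u a₂ c ∩ connEvent ends u o)) * (prob p (PDEvent ends u a₂ c ∩ connEvent ends a₂ b) + prob p (TEvent ends u a₂ c ∩ connEvent ends a₂ b)) := by
  classical
  have h := bhk_cross_cluster_avoid p hp ends u a₂ (X := {a₂, c}) (Finset.mem_insert_self a₂ {c})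
    (isUpperSet_mem_setOf o) (isUpperSet_mem_setOf b)
  rw [← connEvent_eq_clusterInEvent ends u o, ← connEvent_eq_clusterInEvent ends a₂ b, oL_bK_R_eq,
    Set.inter_comm (connEvent ends u o) (avoidAll ends u {a₂, c}),
    Set.inter_comm (connEvent ends a₂ b) (avoidAll ends u {a₂, c}),
    ← ISplit.prob_PD_add_T p ends u a₂ c (connEvent ends u o ∩ connEvent ends a₂ b),
    ← ISplit.prob_PD_add_T p ends u a₂ c (connEvent ends u o),
    ← ISplit.prob_PD_add_T p ends u a₂ c (connEvent ends a₂ b)] at h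
  have hR : prob p (PDEvent ends u a₂ c) + prob p (TEvent ends u a₂ c) = prob p (avoidAll ends u {a₂, c}) := by
    have h' := ISplit.prob_PD_add_T p ends u a₂ c Set.univ
    simpa only [Set.inter_univ] using h'
  rw [← hR] at h
  exact h

/-- **`0 ≤ T2oL` on every instance with `0 ≤ B1`**: the reduction of the `o ∈ L` half to the one pocket-class
statement `B1 = t·P(T,oL,bL) − P(T,oL)·P(T,bL) ≥ 0`. -/
theorem T2oL_nonneg_of_B1 (hp : IsProbVec p)
    (hB1 : 0 ≤ prob p (TEvent ends u a₂ c) * prob p (TEvent ends u a₂ c ∩ (connEvent ends u o ∩ connEvent ends u b)) - prob p (TEvent ends u a₂ c ∩ connEvent ends u o) * prob p (TEvent ends u a₂ c ∩ connEvent ends u b)) : 0 ≤ T2oL p ends o a₂ c b u := by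
  classical
  have hOU : 0 ≤ ((prob p (PDEvent ends u a₂ c) * prob p (connEvent ends a₂ b) + prob p (avoidAll ends a₂ {c}) * gap p ends u a₂ b) + (prob p Set.univ * EQb3 p ends u a₂ c b + prob p Set.univ * PDb p ends u a₂ c b + prob p (connEvent ends a₂ b) * EQ3 p ends u a₂ c + prob p (connEvent ends a₂ b) * prob p (avoidAll ends a₂ {u}) - (prob p Set.univ - prob p (avoidAll ends a₂ {c})) * gap p ends u a₂ b)) * prob p (PDEvent ends u a₂ c) + 2 * (prob p (PDEvent ends u a₂ c) * prob p (connEvent ends a₂ b) + prob p (avoidAll ends a₂ {c}) * gap p ends u a₂ b) * prob p (TEvent ends u a₂ c) + 2 * (prob p Set.univ * prob p (PDEvent ends u a₂ c) + prob p (avoidAll ends a₂ {c}) * prob p (avoidAll ends a₂ {u})) * prob p (TEvent ends u a₂ c ∩ connEvent ends u b) - 2 * (prob p Set.univ * prob p (PDEvent ends u a₂ c) + prob p (avoidAll ends a₂ {c}) * prob p (avoidAll ends a₂ {u})) * (prob p (PDEvent ends u a₂ c ∩ connEvent ends a₂ b) + prob p (TEvent ends u a₂ c ∩ connEvent ends a₂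 b)) := by
    rw [← OU_eq]
    exact T2oL_root_nonneg p ends a₂ c b u hp
  have hi := claim_i p ends a₂ c b u hp
  have hiii := claim_iii p ends o a₂ c b u hp
  have hδ := ToL_mul_D_le p hp ends o u a₂ c
  have hB2 := R_oL_bK_mul_W_le p ends o a₂ c b u hp
  have hmaster := master_identity p ends o a₂ c b u
  have n_t := prob_nonneg hp (TEvent ends u a₂ c)
  have n_D := prob_nonneg hp (PDEvent ends u a₂ c)
  have n_ToL := prob_nonneg hp (TEvent ends u a₂ c ∩ connEvent ends u o)
  have n_d0 := prob_nonneg hp (avoidAll ends a₂ {c})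
  have n_Z := prob_nonneg hp (avoidAll ends a₂ {u})
  have n_β : 0 ≤ (prob p Set.univ * prob p (PDEvent ends u a₂ c) + prob p (avoidAll ends a₂ {c}) * prob p (avoidAll ends a₂ {u})) := by
    rw [prob_univ]
    nlinarith [mul_nonneg n_d0 n_Z]
  rcases eq_or_lt_of_le n_t with ht0 | htpos
  · -- `t = 0`: the `T`-masses of `T2oL` vanish and `T2oL = A·P(PD,oL) − 2β·P(PD,oL,bK)` is claim (iii)
    have h1 : prob p (TEvent ends u a₂ c ∩ connEvent ends u o) = 0 :=
      le_antisymm (ht0 ▸ prob_mono hp Set.inter_subset_left) (prob_nonneg hp _)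
    have h2 : prob p (TEvent ends u a₂ c ∩ (connEvent ends u o ∩ connEvent ends u b)) = 0 :=
      le_antisymm (ht0 ▸ prob_mono hp Set.inter_subset_left) (prob_nonneg hp _)
    have h3 : prob p (TEvent ends u a₂ c ∩ (connEvent ends u o ∩ connEvent ends a₂ b)) = 0 :=
      le_antisymm (ht0 ▸ prob_mono hp Set.inter_subset_left) (prob_nonneg hp _)
    unfold T2oL
    rw [h1, h2, h3]
    simp only [mul_zero, add_zero]
    exact hiii
  · -- `t > 0`: `W·t·T2oL = W·X1 + W·ToL·(OU) ≥ 0`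
    have hW : 0 < (prob p (PDEvent ends u a₂ c) + prob p (TEvent ends u a₂ c)) := by linarith
    have p1 : 0 ≤ (prob p (TEvent ends u a₂ c) * prob p (PDEvent ends u a₂ c ∩ connEvent ends u o) - prob p (PDEvent ends u a₂ c) * prob p (TEvent ends u a₂ c ∩ connEvent ends u o)) * ((prob p (PDEvent ends u a₂ c) + prob p (TEvent ends u a₂ c)) * ((prob p (PDEvent ends u a₂ c) * prob p (connEvent ends a₂ b) + prob p (avoidAll ends a₂ {c}) * gap p ends u a₂ b) + (prob p Set.univ * EQb3 p ends u a₂ c b + prob p Set.univ * PDb p ends u a₂ c b + prob p (connEvent ends a₂ b) * EQ3 p ends u a₂ c + prob p (connEvent ends a₂ b) * prob p (avoidAll ends a₂ {u}) - (prob p Set.univ - prob p (avoidAll ends a₂ {c})) * gap p ends u a₂ b)) - 2 * (prob p Set.univ * prob p (PDEvent ends u a₂ c) + prob p (avoidAll ends a₂ {c}) * prob p (avoidAll ends a₂ {u})) * (prob p (PDEvent ends u a₂ c ∩ connEvent ends a₂ b) + prob p (TEvent ends u a₂ c ∩ connEvent ends a₂ b))) :=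
      mul_nonneg (by linarith) hi
    have p2 : 0 ≤ 2 * (prob p Set.univ * prob p (PDEvent ends u a₂ c) + prob p (avoidAll ends a₂ {c}) * prob p (avoidAll ends a₂ {u})) * (prob p (PDEvent ends u a₂ c) + prob p (TEvent ends u a₂ c)) * (prob p (TEvent ends u a₂ c) * prob p (TEvent ends u a₂ c ∩ (connEvent ends u o ∩ connEvent ends u b)) - prob p (TEvent ends u a₂ c ∩ connEvent ends u o) * prob p (TEvent ends u a₂ c ∩ connEvent ends u b)) :=
      mul_nonneg (mul_nonneg (mul_nonneg (by norm_num) n_β) hW.le) hB1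
    have p3 : 0 ≤ 2 * (prob p Set.univ * prob p (PDEvent ends u a₂ c) + prob p (avoidAll ends a₂ {c}) * prob p (avoidAll ends a₂ {u})) * (prob p (TEvent ends u a₂ c) * ((prob p (PDEvent ends u a₂ c ∩ connEvent ends u o) + prob p (TEvent ends u a₂ c ∩ connEvent ends u o)) * (prob p (PDEvent ends u a₂ c ∩ connEvent ends a₂ b) + prob p (TEvent ends u a₂ c ∩ connEvent ends a₂ b)) - (prob p (PDEvent ends u a₂ c ∩ (connEvent ends u o ∩ connEvent ends a₂ b)) + prob p (TEvent ends u a₂ c ∩ (connEvent ends u o ∩ connEvent ends a₂ b))) * (prob p (PDEvent ends u a₂ c) + prob p (TEvent ends u a₂ c)))) :=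
      mul_nonneg (mul_nonneg (by norm_num) n_β) (mul_nonneg n_t (by linarith))
    have p4 : 0 ≤ (prob p (PDEvent ends u a₂ c) + prob p (TEvent ends u a₂ c)) * prob p (TEvent ends u a₂ c ∩ connEvent ends u o) * (((prob p (PDEvent ends u a₂ c) * prob p (connEvent ends a₂ b) + prob p (avoidAll ends a₂ {c}) * gap p ends u a₂ b) + (prob p Set.univ * EQb3 p ends u a₂ c b + prob p Set.univ * PDb p ends u a₂ c b + prob p (connEvent ends a₂ b) * EQ3 p ends u a₂ c + prob p (connEvent ends a₂ b) * prob p (avoidAll ends a₂ {u}) - (prob p Set.univ - prob p (avoidAll ends a₂ {c})) * gap p ends u a₂ b)) * prob p (PDEvent ends u a₂ c) + 2 * (prob p (PDEvent ends u a₂ c) * prob p (connEvent ends a₂ b) + prob p (avoidAll ends a₂ {c}) * gap p ends u a₂ b) * prob p (TEvent ends u a₂ c) + 2 * (prob p Set.univ * prob p (PDEvent ends u a₂ c) + prob p (avoidAll ends a₂ {c}) * prob p (avoidAll ends a₂ {u})) * prob p (TEvent ends u a₂ c ∩ connEvent ends u b) - 2 * (prob p Set.univ * prob p (PDEvent ends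 u a₂ c) + prob p (avoidAll ends a₂ {c}) * prob p (avoidAll ends a₂ {u})) * (prob p (PDEvent ends u a₂ c ∩ connEvent ends a₂ b) + prob p (TEvent ends u a₂ c ∩ connEvent ends a₂ b))) :=
      mul_nonneg (mul_nonneg hW.le n_ToL) hOU
    have key : (prob p (PDEvent ends u a₂ c) + prob p (TEvent ends u a₂ c)) * prob p (TEvent ends u a₂ c) * T2oL p ends o a₂ c b u =
        (prob p (TEvent ends u a₂ c) * prob p (PDEvent ends u a₂ c ∩ connEvent ends u o) - prob p (PDEvent ends u a₂ c) * prob p (TEvent ends u a₂ c ∩ connEvent ends u o)) * ((prob p (PDEvent ends u a₂ c) + prob p (TEvent ends u a₂ c)) * ((prob p (PDEvent ends u a₂ c) * prob p (connEvent ends a₂ b) + prob p (avoidAll ends a₂ {c}) * gap p ends u a₂ b) + (prob p Set.univ * EQb3 p ends u a₂ c b + prob p Set.univ * PDb p ends u a₂ c b + prob p (connEvent ends a₂ b) * EQ3 p ends u a₂ c + prob p (connEvent ends a₂ b) * prob p (avoidAll ends a₂ {u}) - (prob p Set.univ - prob p (avoidAll ends a₂ {c})) * gap p ends u a₂ b))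 - 2 * (prob p Set.univ * prob p (PDEvent ends u a₂ c) + prob p (avoidAll ends a₂ {c}) * prob p (avoidAll ends a₂ {u})) * (prob p (PDEvent ends u a₂ c ∩ connEvent ends a₂ b) + prob p (TEvent ends u a₂ c ∩ connEvent ends a₂ b))) +
          2 * (prob p Set.univ * prob p (PDEvent ends u a₂ c) + prob p (avoidAll ends a₂ {c}) * prob p (avoidAll ends a₂ {u})) * (prob p (PDEvent ends u a₂ c) + prob p (TEvent ends u a₂ c)) * (prob p (TEvent ends u a₂ c) * prob p (TEvent ends u a₂ c ∩ (connEvent ends u o ∩ connEvent ends u b)) - prob p (TEvent ends u a₂ c ∩ connEvent ends u o) * prob p (TEvent ends u a₂ c ∩ connEvent ends u b)) +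
          2 * (prob p Set.univ * prob p (PDEvent ends u a₂ c) + prob p (avoidAll ends a₂ {c}) * prob p (avoidAll ends a₂ {u})) * (prob p (TEvent ends u a₂ c) * ((prob p (PDEvent ends u a₂ c ∩ connEvent ends u o) + prob p (TEvent ends u a₂ c ∩ connEvent ends u o)) * (prob p (PDEvent ends u a₂ c ∩ connEvent ends a₂ b) + prob p (TEvent ends u a₂ c ∩ connEvent ends a₂ b)) - (prob p (PDEvent ends u a₂ c ∩ (connEvent ends u o ∩ connEvent ends a₂ b)) + prob p (TEvent ends u a₂ c ∩ (connEvent ends u o ∩ connEvent ends a₂ b))) * (prob p (PDEvent ends u a₂ c) + prob p (TEvent ends u a₂ c)))) +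
          (prob p (PDEvent ends u a₂ c) + prob p (TEvent ends u a₂ c)) * prob p (TEvent ends u a₂ c ∩ connEvent ends u o) * (((prob p (PDEvent ends u a₂ c) * prob p (connEvent ends a₂ b) + prob p (avoidAll ends a₂ {c}) * gap p ends u a₂ b) + (prob p Set.univ * EQb3 p ends u a₂ c b + prob p Set.univ * PDb p ends u a₂ c b + prob p (connEvent ends a₂ b) * EQ3 p ends u a₂ c + prob p (connEvent ends a₂ b) * prob p (avoidAll ends a₂ {u}) - (prob p Set.univ - prob p (avoidAll ends a₂ {c})) * gap p ends u a₂ b)) * prob p (PDEvent ends u a₂ c) + 2 * (prob p (PDEvent ends u a₂ c) * prob p (connEvent ends a₂ b) + prob p (avoidAll ends a₂ {c}) * gap p ends u a₂ b) * prob p (TEvent ends u a₂ c) + 2 * (prob p Set.univ * prob p (PDEvent ends u a₂ c) + prob p (avoidAll ends a₂ {c}) * prob p (avoidAll ends a₂ {u})) * prob p (TEvent ends u a₂ c ∩ connEvent ends u b) - 2 * (prob p Set.univ * prob p (PDEvent ends u a₂ c) + prob p (avoidAll ends a₂ {c}) * prob p (avoidAll ends a₂ {u})) * (prob p (PDEvent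 ends u a₂ c ∩ connEvent ends a₂ b) + prob p (TEvent ends u a₂ c ∩ connEvent ends a₂ b))) := by
      rw [W_mul_t_mul_T2oL_eq p ends o a₂ c b u, hmaster]
      ring
    have hpos : 0 ≤ (prob p (PDEvent ends u a₂ c) + prob p (TEvent ends u a₂ c)) * prob p (TEvent ends u a₂ c) * T2oL p ends o a₂ c b u := by
      rw [key]
      linarith
    by_contra hneg
    have := mul_neg_of_pos_of_neg (mul_pos hW htpos) (not_le.mp hneg)
    linarith

end LMaster

end RootLeafU

end Summit.Ventures.PercRepro2
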